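import Summits.QuantumFields.YangMills.Theorems.UnitScaleTiltProp7FramedScalarMatrix
import Summits.QuantumFields.YangMills.Theorems.UnitScaleTiltProp7CovPinnedKernelL1OfRows
import Summits.QuantumFields.YangMills.Theorems.UnitScaleTiltProp7HSOpNormSeam
import HarnessLib

/-!
# Route `UnitScaleTilt`, crux K1 «MinimiserStabilityRegPr» (stmt-QuantumFields-19200), route-R E′ path (α′), (E1-b) at the CURVED background — near-field transplant, brick 2 «TRANSPLANT NORMS»:
# THE `hs`-NUMBERS OF A FRAME-TRANSPORTED «SCALAR × CONSTANT» FIELD `z ↦ ψ(z)•R(Fr z)Y` — pointwise `√hs(Δ_U(ψ•R(Fr)Y)) ≤ |Δψ|·√hs Y + √N·‖Y‖·(frame junk)`, its ℓ¹ sum over the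
# support and its `ω²`-weighted ℓ² twin: the four numbers `N₂, N₃, N₄, N_h` px22's covariant door ✓p673628 consumes, from ONE engine (bus LOCATE 22:33Z)

Cell `ym3-torus`, extra width seat `ym-routeR-w6` (gen 6).  THEOREMS ONLY (0 `def`, 0 `sorry`); `--supports stmt-QuantumFields-19200`, count-neutral.  YM₃ on T³ is a ladder rung (R3),
not the Clay problem; nothing here claims a stub, the crux, d = 4 or the mass gap.

WHAT IS PROVED (ns `…Theorems.Prop7TransplantNorms`; torus `Site P i`, `T = torusT P i`, bi-contractive `U` and frame `Fr`, `hs X = Σ_j Σ_k ‖X j k‖²`, `Δ_Uf x := divB T U (fun μ => covD T U μ f) x`).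
* §1 letters: `hs_R_le` (`hs(R(g)Y) ≤ hs Y`, bi-contractive `g`), (`√hs E ≤ √N·‖E‖` = ✓`Prop7HSOpNormSeam.sqrt_hs_le_sqrt_card_mul_norm`), `covLaplace_eq_zero_of_vanish` (a field vanishing at `z` and its `2d` neighbours has
  `Δ_U(·)(z) = 0`), `sqrt_hs_smul`.
* §2 ★★★ `sqrt_hs_covLaplace_framedConst_le` — POINTWISE: `√hs(Δ_U(ψ•R(Fr ·)Y)(x)) ≤ |Σ_μ(2ψ x − ψ(T_μx) − ψ(T_μ⁻¹x))|·√hs Y + √N·‖Y‖·Σ_μ[(2τ₂+4τ₁²)|ψ x| + 2τ₁|ψ(T_μx) − ψ x| +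
  2τ₁|ψ(T_μ⁻¹x) − ψ x|]` under the framed-link rows of ✓p674125 at `x` (sizes at `x`, `T_μ⁻¹x` `≤ τ₁`; longitudinal difference `≤ τ₂` — pointwise numbers, so routeR-w4's CONE currency
  `τ₁ = (τ₂′+2τ₁′²)·(tdist + 1)` is admissible verbatim).
* §3 ★★★ `sum_sqrt_hs_covLaplace_framedConst_le` — ℓ¹: for `ψ` vanishing with its neighbours off a finset `S` and pointwise row FUNCTIONS `t₁ t₂ : Site → ℝ` on `S`:
  `Σ_z √hs(Δ_U(ψ•RY) z) ≤ √hs Y·Σ_{z∈S}|Δψ z| + √N‖Y‖·Σ_{z∈S}Σ_μ[(2t₂ z+4(t₁ z)²)|ψ z| + 2t₁ z(|ψ(T_μz) − ψ z| + |ψ(T_μ⁻¹z) − ψ z|)]` (the `N₂`∕`N₃` engine), and ★★ `…_le_card_mul`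
  (uniform bounds `Ψ₀ Ψ₁ Ψ₂`, `t₁ ≤ τ₁`, `t₂ ≤ τ₂` on `S`: `≤ #S·(Ψ₂√hs Y + √N‖Y‖·d·((2τ₂+4τ₁²)Ψ₀ + 4τ₁Ψ₁))`).
* §4 ★★★ `sqrt_weighted_hs_covLaplace_framedConst_le` — the `ω²`-weighted twin under `0 ≤ ω ≤ Ω` on `S` (the `N_h`∕`N₄` engine): `√(Σ_z ω z²·hs(Δ_U(ψ•RY) z)) ≤ Ω·√#S·(Ψ₂√hs Y +
  √N‖Y‖·d·((2τ₂+4τ₁²)Ψ₀ + 4τ₁Ψ₁))`.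
HONEST SCOPE.  Pointwise∕counting algebra over ✓p674125; the radial instances (`Σ(1∨r)⁻²` by ✓p672925, `Ω = ω(y₀)e^{κ(ρ+1)∕ℓ}` by ✓`…TorusExpWeightSum`) are the consumer's one-liners.

References: T. Bałaban, CMP 99 (1985) 389–434 [Balaban1985BackgroundPropagators] ((3.8) p.392, (3.28) p.395, (3.35) p.396); CMP 96 (1984) 223–250 [Balaban1984PropagatorsII] ((1.9) p.226).
-/

set_option autoImplicit false

noncomputable section

open scoped BigOperators Matrix.Norms.L2Operator Matrix

namespace Summit.QuantumFields.YangMills.Theorems.Prop7TransplantNorms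

open Literature.MathematicalPhysics.QuantumFieldTheory.Balaban1983to89
open B9Eq39Adjoint (R R_def covD covDstar divB)
open B9TorusCalculus (torusT torusT_apply torusT_symm_apply)
open Summit.QuantumFields.YangMills.Theorems.Prop7CovariantCoercivity (sum_norm_sq_le_mul_opNorm_sq sum_norm_sq_mul_le sum_norm_sq_mul_le')
open Summit.QuantumFields.YangMills.Theorems.Prop7CovAgmonLetters (hs_smul)
open Summit.QuantumFields.YangMills.Theorems.Prop7CovPinnedKernelL1OfRows (sqrt_hs_add_le)
open Summit.QuantumFields.YangMills.Theorems.Prop7FramedScalarMatrix (norm_covLaplace_framedConst_sub_le)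
open Summit.QuantumFields.YangMills.Theorems.Prop7HSOpNormSeam (sqrt_hs_le_sqrt_card_mul_norm)

variable {P : Params} {i : ℕ} {N : ℕ}

/-! ## §1 Letters -/

/-- `hs(R(g)Y) ≤ hs Y` for a bi-contractive `g` (`R(g)Y = g·Y·g⁻¹`, `hs(XY) ≤ ‖X‖²hs Y`, `hs(YX) ≤ hs Y·‖X‖²`). [folklore] -/
theorem hs_R_le {g : (Matrix (Fin N) (Fin N) ℂ)ˣ}
    (hg : ‖(g : Matrix (Fin N) (Fin N) ℂ)‖ ≤ 1 ∧ ‖((g⁻¹ : (Matrix (Fin N) (Fin N) ℂ)ˣ) : Matrix (Fin N) (Fin N) ℂ)‖ ≤ 1) (Y : Matrix (Fin N) (Fin N) ℂ) :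
    ∑ j : Fin N, ∑ k : Fin N, ‖(R g Y) j k‖ ^ 2 ≤ ∑ j : Fin N, ∑ k : Fin N, ‖Y j k‖ ^ 2 := by
  have h0 : 0 ≤ ∑ j : Fin N, ∑ k : Fin N, ‖Y j k‖ ^ 2 := Finset.sum_nonneg fun _ _ => Finset.sum_nonneg fun _ _ => sq_nonneg _
  rw [R_def, mul_assoc]
  have hA := sum_norm_sq_mul_le (g : Matrix (Fin N) (Fin N) ℂ) (Y * ((g⁻¹ : (Matrix (Fin N) (Fin N) ℂ)ˣ) : Matrix (Fin N) (Fin N) ℂ))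
  have hB := sum_norm_sq_mul_le' Y ((g⁻¹ : (Matrix (Fin N) (Fin N) ℂ)ˣ) : Matrix (Fin N) (Fin N) ℂ)
  have hg1 : ‖(g : Matrix (Fin N) (Fin N) ℂ)‖ ^ 2 ≤ 1 := by
    calc _ ≤ (1 : ℝ) ^ 2 := pow_le_pow_left₀ (norm_nonneg _) hg.1 2
      _ = 1 := one_pow 2
  have hg2 : ‖((g⁻¹ : (Matrix (Fin N) (Fin N) ℂ)ˣ) : Matrix (Fin N) (Fin N) ℂ)‖ ^ 2 ≤ 1 := by
    calc _ ≤ (1 : ℝ) ^ 2 := pow_le_pow_left₀ (norm_nonneg _) hg.2 2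
      _ = 1 := one_pow 2
  have hY0 : 0 ≤ ∑ j : Fin N, ∑ k : Fin N, ‖(Y * ((g⁻¹ : (Matrix (Fin N) (Fin N) ℂ)ˣ) : Matrix (Fin N) (Fin N) ℂ)) j k‖ ^ 2 :=
    Finset.sum_nonneg fun _ _ => Finset.sum_nonneg fun _ _ => sq_nonneg _
  calc _ ≤ ‖(g : Matrix (Fin N) (Fin N) ℂ)‖ ^ 2 * ∑ j : Fin N, ∑ k : Fin N, ‖(Y * ((g⁻¹ : (Matrix (Fin N) (Fin N) ℂ)ˣ) : Matrix (Fin N) (Fin N) ℂ)) j k‖ ^ 2 := hA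
    _ ≤ 1 * ((∑ j : Fin N, ∑ k : Fin N, ‖Y j k‖ ^ 2) * ‖((g⁻¹ : (Matrix (Fin N) (Fin N) ℂ)ˣ) : Matrix (Fin N) (Fin N) ℂ)‖ ^ 2) :=
        mul_le_mul hg1 hB hY0 zero_le_one
    _ ≤ 1 * ((∑ j : Fin N, ∑ k : Fin N, ‖Y j k‖ ^ 2) * 1) := by gcongr
    _ = _ := by ring

/-- `√hs(r•X) = |r|·√hs X`. [folklore] -/
theorem sqrt_hs_smul (r : ℝ) (X : Matrix (Fin N) (Fin N) ℂ) :
    Real.sqrt (∑ j : Fin N, ∑ k : Fin N, ‖(r • X) j k‖ ^ 2) = |r| * Real.sqrt (∑ j : Fin N, ∑ k : Fin N, ‖X j k‖ ^ 2) := by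
  rw [hs_smul, Real.sqrt_mul (sq_nonneg r), Real.sqrt_sq_eq_abs]

/-- a field vanishing at `z` and at its `2d` neighbours has `Δ_U(·)(z) = 0`. [cite: Balaban1985BackgroundPropagators, (3.8) p.392] -/
theorem covLaplace_eq_zero_of_vanish (U : Fin P.d → Site P i → (Matrix (Fin N) (Fin N) ℂ)ˣ) (f : Site P i → Matrix (Fin N) (Fin N) ℂ) (z : Site P i)
    (h0 : f z = 0) (h1 : ∀ μ, f (torusT P i μ z) = 0) (h2 : ∀ μ, f ((torusT P i μ).symm z) = 0) :
    divB (torusT P i) U (fun μ => covD (torusT P i) U μ f) z = 0 := by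
  simp only [divB, covDstar, covD, Equiv.apply_symm_apply, h0, h1, h2, R_def, mul_zero, zero_mul, sub_zero, Finset.sum_const_zero]

/-! ## §2 ★★★ Pointwise -/

/-- ★★★ **POINTWISE `√hs` OF THE COVARIANT LAPLACIAN OF A FRAME-TRANSPORTED «SCALAR × CONSTANT»**. [cite: Balaban1985BackgroundPropagators, (3.8) p.392, (3.28) p.395, (3.35) p.396] -/
theorem sqrt_hs_covLaplace_framedConst_le (U : Fin P.d → Site P i → (Matrix (Fin N) (Fin N) ℂ)ˣ) (Fr : Site P i → (Matrix (Fin N) (Fin N) ℂ)ˣ)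
    (hU : ∀ (κ : Fin P.d) (y : Site P i), ‖(U κ y : Matrix (Fin N) (Fin N) ℂ)‖ ≤ 1 ∧ ‖(((U κ y)⁻¹ : (Matrix (Fin N) (Fin N) ℂ)ˣ) : Matrix (Fin N) (Fin N) ℂ)‖ ≤ 1)
    (hFr : ∀ z : Site P i, ‖(Fr z : Matrix (Fin N) (Fin N) ℂ)‖ ≤ 1 ∧ ‖(((Fr z)⁻¹ : (Matrix (Fin N) (Fin N) ℂ)ˣ) : Matrix (Fin N) (Fin N) ℂ)‖ ≤ 1)
    (ψ : Site P i → ℝ) (Y : Matrix (Fin N) (Fin N) ℂ) (x : Site P i) {τ₁ τ₂ : ℝ}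
    (h1 : ∀ μ, ‖(((Fr x)⁻¹ * U μ x * Fr (torusT P i μ x) : (Matrix (Fin N) (Fin N) ℂ)ˣ) : Matrix (Fin N) (Fin N) ℂ) - 1‖ ≤ τ₁)
    (h1' : ∀ μ, ‖(((Fr ((torusT P i μ).symm x))⁻¹ * U μ ((torusT P i μ).symm x) * Fr (torusT P i μ ((torusT P i μ).symm x)) : (Matrix (Fin N) (Fin N) ℂ)ˣ) :
      Matrix (Fin N) (Fin N) ℂ) - 1‖ ≤ τ₁)
    (h2 : ∀ μ, ‖(((Fr x)⁻¹ * U μ x * Fr (torusT P i μ x) : (Matrix (Fin N) (Fin N) ℂ)ˣ) : Matrix (Fin N) (Fin N) ℂ)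
      - (((Fr ((torusT P i μ).symm x))⁻¹ * U μ ((torusT P i μ).symm x) * Fr (torusT P i μ ((torusT P i μ).symm x)) : (Matrix (Fin N) (Fin N) ℂ)ˣ) :
        Matrix (Fin N) (Fin N) ℂ)‖ ≤ τ₂) :
    Real.sqrt (∑ j : Fin N, ∑ k : Fin N, ‖(divB (torusT P i) U (fun μ => covD (torusT P i) U μ (fun z => ψ z • R (Fr z) Y)) x) j k‖ ^ 2)
      ≤ |∑ μ : Fin P.d, (2 * ψ x - ψ (torusT P i μ x) - ψ ((torusT P i μ).symm x))| * Real.sqrt (∑ j : Fin N, ∑ k : Fin N, ‖Y j k‖ ^ 2)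
        + Real.sqrt N * (‖Y‖ * ∑ μ : Fin P.d, ((2 * τ₂ + 4 * τ₁ ^ 2) * |ψ x| + 2 * τ₁ * |ψ (torusT P i μ x) - ψ x| + 2 * τ₁ * |ψ ((torusT P i μ).symm x) - ψ x|)) := by
  set Z := divB (torusT P i) U (fun μ => covD (torusT P i) U μ (fun z => ψ z • R (Fr z) Y)) x with hZ
  set M := (∑ μ : Fin P.d, (2 * ψ x - ψ (torusT P i μ x) - ψ ((torusT P i μ).symm x))) • R (Fr x) Y with hM
  have hE : ‖Z - M‖ ≤ ∑ μ : Fin P.d, ((2 * τ₂ + 4 * τ₁ ^ 2) * |ψ x| + 2 * τ₁ * |ψ (torusT P i μ x) - ψ x| + 2 * τ₁ * |ψ ((torusT P i μ).symm x) - ψ x|) * ‖Y‖ :=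
    norm_covLaplace_framedConst_sub_le (torusT P i) U Fr hU hFr ψ Y x h1 h1' h2
  have e : Z = M + (Z - M) := by abel
  rw [e]
  refine (sqrt_hs_add_le M (Z - M)).trans (add_le_add ?_ ?_)
  · rw [hM, sqrt_hs_smul]
    exact mul_le_mul_of_nonneg_left (Real.sqrt_le_sqrt (hs_R_le (hFr x) Y)) (abs_nonneg _)
  · refine (sqrt_hs_le_sqrt_card_mul_norm (Z - M)).trans (mul_le_mul_of_nonneg_left (hE.trans (le_of_eq ?_)) (Real.sqrt_nonneg _))
    rw [Finset.mul_sum]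
    exact Finset.sum_congr rfl fun μ _ => mul_comm _ _

/-! ## §3 ★★★ The ℓ¹ number -/

/-- ★★★ **ℓ¹ SUM** of `√hs(Δ_U(ψ•R(Fr)Y))` over the torus, for `ψ` vanishing with its neighbours off a finset `S`, with POINTWISE row functions `t₁ t₂` on `S` (cone currency admissible).
[cite: Balaban1985BackgroundPropagators, (3.8) p.392, (3.35) p.396; Balaban1984PropagatorsII, (1.9) p.226] -/
theorem sum_sqrt_hs_covLaplace_framedConst_le (U : Fin P.d → Site P i → (Matrix (Fin N) (Fin N) ℂ)ˣ) (Fr : Site P i → (Matrix (Fin N) (Fin N) ℂ)ˣ)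
    (hU : ∀ (κ : Fin P.d) (y : Site P i), ‖(U κ y : Matrix (Fin N) (Fin N) ℂ)‖ ≤ 1 ∧ ‖(((U κ y)⁻¹ : (Matrix (Fin N) (Fin N) ℂ)ˣ) : Matrix (Fin N) (Fin N) ℂ)‖ ≤ 1)
    (hFr : ∀ z : Site P i, ‖(Fr z : Matrix (Fin N) (Fin N) ℂ)‖ ≤ 1 ∧ ‖(((Fr z)⁻¹ : (Matrix (Fin N) (Fin N) ℂ)ˣ) : Matrix (Fin N) (Fin N) ℂ)‖ ≤ 1)
    (ψ : Site P i → ℝ) (Y : Matrix (Fin N) (Fin N) ℂ) (S : Finset (Site P i))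
    (hS : ∀ z ∉ S, ψ z = 0 ∧ (∀ μ, ψ (torusT P i μ z) = 0) ∧ ∀ μ, ψ ((torusT P i μ).symm z) = 0)
    (t₁ t₂ : Site P i → ℝ)
    (h1 : ∀ z ∈ S, ∀ μ, ‖(((Fr z)⁻¹ * U μ z * Fr (torusT P i μ z) : (Matrix (Fin N) (Fin N) ℂ)ˣ) : Matrix (Fin N) (Fin N) ℂ) - 1‖ ≤ t₁ z)
    (h1' : ∀ z ∈ S, ∀ μ, ‖(((Fr ((torusT P i μ).symm z))⁻¹ * U μ ((torusT P i μ).symm z) * Fr (torusT P i μ ((torusT P i μ).symm z)) : (Matrix (Fin N) (Fin N) ℂ)ˣ) :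
      Matrix (Fin N) (Fin N) ℂ) - 1‖ ≤ t₁ z)
    (h2 : ∀ z ∈ S, ∀ μ, ‖(((Fr z)⁻¹ * U μ z * Fr (torusT P i μ z) : (Matrix (Fin N) (Fin N) ℂ)ˣ) : Matrix (Fin N) (Fin N) ℂ)
      - (((Fr ((torusT P i μ).symm z))⁻¹ * U μ ((torusT P i μ).symm z) * Fr (torusT P i μ ((torusT P i μ).symm z)) : (Matrix (Fin N) (Fin N) ℂ)ˣ) :
        Matrix (Fin N) (Fin N) ℂ)‖ ≤ t₂ z) :
    ∑ z, Real.sqrt (∑ j : Fin N, ∑ k : Fin N, ‖(divB (torusT P i) U (fun μ => covD (torusT P i) U μ (fun y => ψ y • R (Fr y) Y)) z) j k‖ ^ 2)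
      ≤ Real.sqrt (∑ j : Fin N, ∑ k : Fin N, ‖Y j k‖ ^ 2) * ∑ z ∈ S, |∑ μ : Fin P.d, (2 * ψ z - ψ (torusT P i μ z) - ψ ((torusT P i μ).symm z))|
        + Real.sqrt N * (‖Y‖ * ∑ z ∈ S, ∑ μ : Fin P.d,
            ((2 * t₂ z + 4 * t₁ z ^ 2) * |ψ z| + 2 * t₁ z * |ψ (torusT P i μ z) - ψ z| + 2 * t₁ z * |ψ ((torusT P i μ).symm z) - ψ z|)) := by
  -- off `S` the field and its neighbours vanish, so the summand is zero there
  have hoff : ∀ z ∈ (Finset.univ : Finset (Site P i)), z ∉ S →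
      Real.sqrt (∑ j : Fin N, ∑ k : Fin N, ‖(divB (torusT P i) U (fun μ => covD (torusT P i) U μ (fun y => ψ y • R (Fr y) Y)) z) j k‖ ^ 2) = 0 := by
    intro z _ hz
    obtain ⟨hz0, hz1, hz2⟩ := hS z hz
    rw [covLaplace_eq_zero_of_vanish U _ z (by show ψ z • _ = 0; rw [hz0, zero_smul]) (fun μ => by show ψ _ • _ = 0; rw [hz1 μ, zero_smul])
      (fun μ => by show ψ _ • _ = 0; rw [hz2 μ, zero_smul])]
    simp
  rw [← Finset.sum_subset (Finset.subset_univ S) hoff, Finset.mul_sum, Finset.mul_sum, Finset.mul_sum, ← Finset.sum_add_distrib]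
  refine Finset.sum_le_sum fun z hz => ?_
  have h := sqrt_hs_covLaplace_framedConst_le U Fr hU hFr ψ Y z (h1 z hz) (h1' z hz) (h2 z hz)
  rw [mul_comm (Real.sqrt _) |_|]
  exact h

/-- ★★ **ℓ¹ SUM, UNIFORM BOUNDS** (`N₃` per bump, cutoff shells): `≤ #S·(Ψ₂·√hs Y + √N·‖Y‖·d·((2τ₂ + 4τ₁²)Ψ₀ + 4τ₁Ψ₁))`. [cite: Balaban1985BackgroundPropagators, (3.35) p.396] -/
theorem sum_sqrt_hs_covLaplace_framedConst_le_card_mul (U : Fin P.d → Site P i → (Matrix (Fin N) (Fin N) ℂ)ˣ) (Fr : Site P i → (Matrix (Fin N) (Fin N) ℂ)ˣ)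
    (hU : ∀ (κ : Fin P.d) (y : Site P i), ‖(U κ y : Matrix (Fin N) (Fin N) ℂ)‖ ≤ 1 ∧ ‖(((U κ y)⁻¹ : (Matrix (Fin N) (Fin N) ℂ)ˣ) : Matrix (Fin N) (Fin N) ℂ)‖ ≤ 1)
    (hFr : ∀ z : Site P i, ‖(Fr z : Matrix (Fin N) (Fin N) ℂ)‖ ≤ 1 ∧ ‖(((Fr z)⁻¹ : (Matrix (Fin N) (Fin N) ℂ)ˣ) : Matrix (Fin N) (Fin N) ℂ)‖ ≤ 1)
    (ψ : Site P i → ℝ) (Y : Matrix (Fin N) (Fin N) ℂ) (S : Finset (Site P i))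
    (hS : ∀ z ∉ S, ψ z = 0 ∧ (∀ μ, ψ (torusT P i μ z) = 0) ∧ ∀ μ, ψ ((torusT P i μ).symm z) = 0)
    {τ₁ τ₂ Ψ₀ Ψ₁ Ψ₂ : ℝ} (hτ₁ : 0 ≤ τ₁)
    (h1 : ∀ z ∈ S, ∀ μ, ‖(((Fr z)⁻¹ * U μ z * Fr (torusT P i μ z) : (Matrix (Fin N) (Fin N) ℂ)ˣ) : Matrix (Fin N) (Fin N) ℂ) - 1‖ ≤ τ₁)
    (h1' : ∀ z ∈ S, ∀ μ, ‖(((Fr ((torusT P i μ).symm z))⁻¹ * U μ ((torusT P i μ).symm z) * Fr (torusT P i μ ((torusT P i μ).symm z)) : (Matrix (Fin N) (Fin N) ℂ)ˣ) :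
      Matrix (Fin N) (Fin N) ℂ) - 1‖ ≤ τ₁)
    (h2 : ∀ z ∈ S, ∀ μ, ‖(((Fr z)⁻¹ * U μ z * Fr (torusT P i μ z) : (Matrix (Fin N) (Fin N) ℂ)ˣ) : Matrix (Fin N) (Fin N) ℂ)
      - (((Fr ((torusT P i μ).symm z))⁻¹ * U μ ((torusT P i μ).symm z) * Fr (torusT P i μ ((torusT P i μ).symm z)) : (Matrix (Fin N) (Fin N) ℂ)ˣ) :
        Matrix (Fin N) (Fin N) ℂ)‖ ≤ τ₂)
    (hΨ₀ : ∀ z ∈ S, |ψ z| ≤ Ψ₀) (hΨ₁ : ∀ z ∈ S, ∀ μ, |ψ (torusT P i μ z) - ψ z| ≤ Ψ₁ ∧ |ψ ((torusT P i μ).symm z) - ψ z| ≤ Ψ₁)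
    (hΨ₂ : ∀ z ∈ S, |∑ μ : Fin P.d, (2 * ψ z - ψ (torusT P i μ z) - ψ ((torusT P i μ).symm z))| ≤ Ψ₂) :
    ∑ z, Real.sqrt (∑ j : Fin N, ∑ k : Fin N, ‖(divB (torusT P i) U (fun μ => covD (torusT P i) U μ (fun y => ψ y • R (Fr y) Y)) z) j k‖ ^ 2)
      ≤ S.card * (Ψ₂ * Real.sqrt (∑ j : Fin N, ∑ k : Fin N, ‖Y j k‖ ^ 2) + Real.sqrt N * ‖Y‖ * (P.d * ((2 * τ₂ + 4 * τ₁ ^ 2) * Ψ₀ + 4 * τ₁ * Ψ₁))) := by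
  have h := sum_sqrt_hs_covLaplace_framedConst_le U Fr hU hFr ψ Y S hS (fun _ => τ₁) (fun _ => τ₂) h1 h1' h2
  refine h.trans ?_
  have hY : 0 ≤ Real.sqrt (∑ j : Fin N, ∑ k : Fin N, ‖Y j k‖ ^ 2) := Real.sqrt_nonneg _
  have hτ₂ : ∀ z ∈ S, 0 ≤ τ₂ := fun z hz => by
    obtain ⟨μ⟩ := (inferInstance : Nonempty (Fin P.d))
    exact (norm_nonneg _).trans (h2 z hz μ)
  have hA : ∑ z ∈ S, |∑ μ : Fin P.d, (2 * ψ z - ψ (torusT P i μ z) - ψ ((torusT P i μ).symm z))| ≤ S.card * Ψ₂ := by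
    calc _ ≤ ∑ z ∈ S, Ψ₂ := Finset.sum_le_sum hΨ₂
      _ = S.card * Ψ₂ := by rw [Finset.sum_const, nsmul_eq_mul]
  have hB : ∑ z ∈ S, ∑ μ : Fin P.d, ((2 * τ₂ + 4 * τ₁ ^ 2) * |ψ z| + 2 * τ₁ * |ψ (torusT P i μ z) - ψ z| + 2 * τ₁ * |ψ ((torusT P i μ).symm z) - ψ z|)
      ≤ S.card * (P.d * ((2 * τ₂ + 4 * τ₁ ^ 2) * Ψ₀ + 4 * τ₁ * Ψ₁)) := by
    calc _ ≤ ∑ z ∈ S, ∑ _μ : Fin P.d, ((2 * τ₂ + 4 * τ₁ ^ 2) * Ψ₀ + 2 * τ₁ * Ψ₁ + 2 * τ₁ * Ψ₁) := by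
          refine Finset.sum_le_sum fun z hz => Finset.sum_le_sum fun μ _ => ?_
          have hc : 0 ≤ 2 * τ₂ + 4 * τ₁ ^ 2 := by nlinarith [hτ₂ z hz, sq_nonneg τ₁]
          gcongr
          · exact hΨ₀ z hz
          · exact (hΨ₁ z hz μ).1
          · exact (hΨ₁ z hz μ).2
      _ = S.card * (P.d * ((2 * τ₂ + 4 * τ₁ ^ 2) * Ψ₀ + 4 * τ₁ * Ψ₁)) := by
          simp only [Finset.sum_const, Finset.card_univ, Fintype.card_fin, nsmul_eq_mul]; ring
  have hN : 0 ≤ Real.sqrt (N : ℝ) * ‖Y‖ := mul_nonneg (Real.sqrt_nonneg _) (norm_nonneg _)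
  calc _ ≤ Real.sqrt (∑ j : Fin N, ∑ k : Fin N, ‖Y j k‖ ^ 2) * (S.card * Ψ₂) + Real.sqrt N * (‖Y‖ * (S.card * (P.d * ((2 * τ₂ + 4 * τ₁ ^ 2) * Ψ₀ + 4 * τ₁ * Ψ₁)))) := by
        gcongr
    _ = _ := by ring

/-! ## §4 ★★★ The `ω²`-weighted number -/

/-- ★★★ **WEIGHTED ℓ² NUMBER** (`N_h`, `N₄`): under `0 ≤ ω ≤ Ω` on `S` and the uniform bounds, `√(Σ_z ω z²·hs(Δ_U(ψ•R(Fr)Y) z)) ≤ Ω·√#S·(Ψ₂√hs Y + √N‖Y‖·d·((2τ₂+4τ₁²)Ψ₀ + 4τ₁Ψ₁))`.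
[cite: Balaban1984PropagatorsII, (1.9) p.226; Balaban1985BackgroundPropagators, (3.35) p.396] -/
theorem sqrt_weighted_hs_covLaplace_framedConst_le (U : Fin P.d → Site P i → (Matrix (Fin N) (Fin N) ℂ)ˣ) (Fr : Site P i → (Matrix (Fin N) (Fin N) ℂ)ˣ)
    (hU : ∀ (κ : Fin P.d) (y : Site P i), ‖(U κ y : Matrix (Fin N) (Fin N) ℂ)‖ ≤ 1 ∧ ‖(((U κ y)⁻¹ : (Matrix (Fin N) (Fin N) ℂ)ˣ) : Matrix (Fin N) (Fin N) ℂ)‖ ≤ 1)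
    (hFr : ∀ z : Site P i, ‖(Fr z : Matrix (Fin N) (Fin N) ℂ)‖ ≤ 1 ∧ ‖(((Fr z)⁻¹ : (Matrix (Fin N) (Fin N) ℂ)ˣ) : Matrix (Fin N) (Fin N) ℂ)‖ ≤ 1)
    (ψ : Site P i → ℝ) (Y : Matrix (Fin N) (Fin N) ℂ) (S : Finset (Site P i))
    (hS : ∀ z ∉ S, ψ z = 0 ∧ (∀ μ, ψ (torusT P i μ z) = 0) ∧ ∀ μ, ψ ((torusT P i μ).symm z) = 0)
    (ω : Site P i → ℝ) {Ω : ℝ} (hω : ∀ z ∈ S, 0 ≤ ω z ∧ ω z ≤ Ω)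
    {τ₁ τ₂ Ψ₀ Ψ₁ Ψ₂ : ℝ} (hτ₁ : 0 ≤ τ₁)
    (h1 : ∀ z ∈ S, ∀ μ, ‖(((Fr z)⁻¹ * U μ z * Fr (torusT P i μ z) : (Matrix (Fin N) (Fin N) ℂ)ˣ) : Matrix (Fin N) (Fin N) ℂ) - 1‖ ≤ τ₁)
    (h1' : ∀ z ∈ S, ∀ μ, ‖(((Fr ((torusT P i μ).symm z))⁻¹ * U μ ((torusT P i μ).symm z) * Fr (torusT P i μ ((torusT P i μ).symm z)) : (Matrix (Fin N) (Fin N) ℂ)ˣ) :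
      Matrix (Fin N) (Fin N) ℂ) - 1‖ ≤ τ₁)
    (h2 : ∀ z ∈ S, ∀ μ, ‖(((Fr z)⁻¹ * U μ z * Fr (torusT P i μ z) : (Matrix (Fin N) (Fin N) ℂ)ˣ) : Matrix (Fin N) (Fin N) ℂ)
      - (((Fr ((torusT P i μ).symm z))⁻¹ * U μ ((torusT P i μ).symm z) * Fr (torusT P i μ ((torusT P i μ).symm z)) : (Matrix (Fin N) (Fin N) ℂ)ˣ) :
        Matrix (Fin N) (Fin N) ℂ)‖ ≤ τ₂)
    (hΨ₀ : ∀ z ∈ S, |ψ z| ≤ Ψ₀) (hΨ₁ : ∀ z ∈ S, ∀ μ, |ψ (torusT P i μ z) - ψ z| ≤ Ψ₁ ∧ |ψ ((torusT P i μ).symm z) - ψ z| ≤ Ψ₁)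
    (hΨ₂ : ∀ z ∈ S, |∑ μ : Fin P.d, (2 * ψ z - ψ (torusT P i μ z) - ψ ((torusT P i μ).symm z))| ≤ Ψ₂) :
    Real.sqrt (∑ z, ω z ^ 2 * ∑ j : Fin N, ∑ k : Fin N, ‖(divB (torusT P i) U (fun μ => covD (torusT P i) U μ (fun y => ψ y • R (Fr y) Y)) z) j k‖ ^ 2)
      ≤ Ω * Real.sqrt S.card * (Ψ₂ * Real.sqrt (∑ j : Fin N, ∑ k : Fin N, ‖Y j k‖ ^ 2) + Real.sqrt N * ‖Y‖ * (P.d * ((2 * τ₂ + 4 * τ₁ ^ 2) * Ψ₀ + 4 * τ₁ * Ψ₁))) := by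
  set B := Ψ₂ * Real.sqrt (∑ j : Fin N, ∑ k : Fin N, ‖Y j k‖ ^ 2) + Real.sqrt N * ‖Y‖ * (P.d * ((2 * τ₂ + 4 * τ₁ ^ 2) * Ψ₀ + 4 * τ₁ * Ψ₁)) with hBdef
  -- pointwise on `S`: `√hs(Δ_U F z) ≤ B`
  have hpt : ∀ z ∈ S, Real.sqrt (∑ j : Fin N, ∑ k : Fin N, ‖(divB (torusT P i) U (fun μ => covD (torusT P i) U μ (fun y => ψ y • R (Fr y) Y)) z) j k‖ ^ 2) ≤ B := by
    intro z hz
    have h := sqrt_hs_covLaplace_framedConst_le U Fr hU hFr ψ Y z (h1 z hz) (h1' z hz) (h2 z hz)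
    refine h.trans ?_
    have hY : 0 ≤ Real.sqrt (∑ j : Fin N, ∑ k : Fin N, ‖Y j k‖ ^ 2) := Real.sqrt_nonneg _
    have hτ₂ : 0 ≤ τ₂ := by
      obtain ⟨μ⟩ := (inferInstance : Nonempty (Fin P.d))
      exact (norm_nonneg _).trans (h2 z hz μ)
    have hsum : ∑ μ : Fin P.d, ((2 * τ₂ + 4 * τ₁ ^ 2) * |ψ z| + 2 * τ₁ * |ψ (torusT P i μ z) - ψ z| + 2 * τ₁ * |ψ ((torusT P i μ).symm z) - ψ z|)
        ≤ P.d * ((2 * τ₂ + 4 * τ₁ ^ 2) * Ψ₀ + 4 * τ₁ * Ψ₁) := by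
      calc _ ≤ ∑ _μ : Fin P.d, ((2 * τ₂ + 4 * τ₁ ^ 2) * Ψ₀ + 2 * τ₁ * Ψ₁ + 2 * τ₁ * Ψ₁) := by
            refine Finset.sum_le_sum fun μ _ => ?_
            have hc : 0 ≤ 2 * τ₂ + 4 * τ₁ ^ 2 := by nlinarith [sq_nonneg τ₁]
            gcongr
            · exact hΨ₀ z hz
            · exact (hΨ₁ z hz μ).1
            · exact (hΨ₁ z hz μ).2
        _ = _ := by rw [Finset.sum_const, Finset.card_univ, Fintype.card_fin, nsmul_eq_mul]; ring
    have hN : 0 ≤ Real.sqrt (N : ℝ) := Real.sqrt_nonneg _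
    calc _ ≤ Ψ₂ * Real.sqrt (∑ j : Fin N, ∑ k : Fin N, ‖Y j k‖ ^ 2) + Real.sqrt N * (‖Y‖ * (P.d * ((2 * τ₂ + 4 * τ₁ ^ 2) * Ψ₀ + 4 * τ₁ * Ψ₁))) := by
          gcongr
          exact hΨ₂ z hz
      _ = B := by rw [hBdef]; ring
  -- off `S` the summand vanishes
  have hoff : ∀ z ∈ (Finset.univ : Finset (Site P i)), z ∉ S →
      ω z ^ 2 * ∑ j : Fin N, ∑ k : Fin N, ‖(divB (torusT P i) U (fun μ => covD (torusT P i) U μ (fun y => ψ y • R (Fr y) Y)) z) j k‖ ^ 2 = 0 := by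
    intro z _ hz
    obtain ⟨hz0, hz1, hz2⟩ := hS z hz
    rw [covLaplace_eq_zero_of_vanish U _ z (by show ψ z • _ = 0; rw [hz0, zero_smul]) (fun μ => by show ψ _ • _ = 0; rw [hz1 μ, zero_smul])
      (fun μ => by show ψ _ • _ = 0; rw [hz2 μ, zero_smul])]
    simp
  rw [← Finset.sum_subset (Finset.subset_univ S) hoff]
  have hle : ∑ z ∈ S, ω z ^ 2 * ∑ j : Fin N, ∑ k : Fin N, ‖(divB (torusT P i) U (fun μ => covD (torusT P i) U μ (fun y => ψ y • R (Fr y) Y)) z) j k‖ ^ 2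
      ≤ ∑ _z ∈ S, Ω ^ 2 * B ^ 2 := by
    refine Finset.sum_le_sum fun z hz => ?_
    have hhs : ∑ j : Fin N, ∑ k : Fin N, ‖(divB (torusT P i) U (fun μ => covD (torusT P i) U μ (fun y => ψ y • R (Fr y) Y)) z) j k‖ ^ 2 ≤ B ^ 2 := by
      have h0 : 0 ≤ ∑ j : Fin N, ∑ k : Fin N, ‖(divB (torusT P i) U (fun μ => covD (torusT P i) U μ (fun y => ψ y • R (Fr y) Y)) z) j k‖ ^ 2 :=
        Finset.sum_nonneg fun _ _ => Finset.sum_nonneg fun _ _ => sq_nonneg _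
      rw [← Real.sq_sqrt h0]
      exact pow_le_pow_left₀ (Real.sqrt_nonneg _) (hpt z hz) 2
    have hω2 : ω z ^ 2 ≤ Ω ^ 2 := pow_le_pow_left₀ (hω z hz).1 (hω z hz).2 2
    exact mul_le_mul hω2 hhs (Finset.sum_nonneg fun _ _ => Finset.sum_nonneg fun _ _ => sq_nonneg _) (sq_nonneg _)
  rcases S.eq_empty_or_nonempty with hS0 | ⟨z₀, hz₀⟩
  · subst hS0
    rw [Finset.sum_empty, Real.sqrt_zero, Finset.card_empty, Nat.cast_zero, Real.sqrt_zero, mul_zero, zero_mul]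
  have hΩ : 0 ≤ Ω := (hω z₀ hz₀).1.trans (hω z₀ hz₀).2
  have hB0 : 0 ≤ B := (Real.sqrt_nonneg _).trans (hpt z₀ hz₀)
  calc _ ≤ Real.sqrt (∑ _z ∈ S, Ω ^ 2 * B ^ 2) := Real.sqrt_le_sqrt hle
    _ = Ω * Real.sqrt S.card * B := by
        rw [Finset.sum_const, nsmul_eq_mul, show (S.card : ℝ) * (Ω ^ 2 * B ^ 2) = (Ω * Real.sqrt S.card * B) ^ 2 by
          rw [mul_pow, mul_pow, Real.sq_sqrt (Nat.cast_nonneg _)]; ring]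
        exact Real.sqrt_sq (mul_nonneg (mul_nonneg hΩ (Real.sqrt_nonneg _)) hB0)

end Summit.QuantumFields.YangMills.Theorems.Prop7TransplantNorms

end
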